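import Summits.KontsevichZagierPeriods.KontsevichZagierPeriods.Theorems.HermiteRigidityIslandComplementBoxLanden
import Literature.NumberTheory.Transcendental.KZRelationsLE

/-!
# `ReductionRigidity` (stmt-KontsevichZagierPeriods-3407), line `Sketch`, cycle 2 (the Landen join island):
# Landen's chain at level `q`, scaled by a rational `ε` (`stub_joinLandenScaled`)

Route `KontsevichZagierPeriods/HermiteRigidity`, crux `ReductionRigidity` (stmt-3407); registered
sub-goal stub J4 of the LANDEN JOIN ISLAND (the box sectors at the two levels `ν = q` and `ν = 1 − q`
of an integer `q ≥ 2`, plus products). For every rational `ε`, in normal-form syntax,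

  `[□², 2ε/(q − xy)] + [□², 2ε/((1 − q) − xy)] + [□², ε/((q − x)(q − y))] ∈ KZ.relations`

— the weight-two CROSS-LEVEL reduction: the level-`(1 − q)` normal form is
`[□², 2ε/((1 − q) − xy)] = −[□², 2ε/((q − 1) + xy)]`, and Landen's identity at `z = 1/q` as a chain
of moves (`stub_boxLanden`: `[□², 2/(q − xy)] − [□², 2/((q − 1) + xy)] + [□², 1/((q − x)(q − y))]
∈ relations`) is pushed through the rational scaling endomorphism `KZ.scale ε` (`[σ, f] ↦ [σ, ε f]`,
which preserves `KZ.relations`: `KZ.scale_mem_relations`), then three congruences (rule 1b) pass to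
arbitrary representations with the printed integrands.

References: M. Kontsevich, D. Zagier, *Periods* (2001), §1.2 rules (1)–(3) [cite: KontsevichZagier2001, §1.2].
No definitions are introduced.
-/

noncomputable section

open MeasureTheory Set MvPolynomial

namespace Summit.KontsevichZagierPeriods.HermiteRigidity.ReductionRigidity

open Literature.NumberTheory.Transcendental
open Literature.NumberTheory.Transcendental.KZ

/-- The three integrands of Landen's chain at an integer level `q ≥ 2`, `2/(q − xy)`,
`2/((q − 1) + xy)` and `1/((q − x)(q − y))`, are regular rational functions on `□²`.
[cite: KontsevichZagier2001, §1.1] -/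
theorem exists_joinLanden_rfun {q : ℕ} (hq : 2 ≤ q) : ∃ R R' RP : RFun 2,
    (∀ x ∈ cube 2, R.fn x = 2 / ((q : ℝ) - x 0 * x 1)) ∧
    (∀ x ∈ cube 2, R'.fn x = 2 / (((q : ℝ) - 1) + x 0 * x 1)) ∧
    (∀ x ∈ cube 2, RP.fn x = 1 / (((q : ℝ) - x 0) * ((q : ℝ) - x 1))) := by
  have h2 : (2:ℝ) ≤ (q:ℝ) := by exact_mod_cast hq
  have hR : ∀ x ∈ cube 2, aeval x (C (q:ℚ) - X 0 * X 1 : MvPolynomial (Fin 2) ℚ) ≠ 0 := by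
    intro x hx
    have h := landen_face_bounds hx
    simp only [map_sub, map_mul, aeval_C, aeval_X, eq_ratCast, Rat.cast_natCast]
    linarith
  have hR' : ∀ x ∈ cube 2, aeval x (C (q:ℚ) - 1 + X 0 * X 1 : MvPolynomial (Fin 2) ℚ) ≠ 0 := by
    intro x hx
    have h := landen_face_bounds hx
    simp only [map_sub, map_add, map_mul, map_one, aeval_C, aeval_X, eq_ratCast, Rat.cast_natCast]
    linarith
  have hRP : ∀ x ∈ cube 2,
      aeval x ((C (q:ℚ) - X 0) * (C (q:ℚ) - X 1) : MvPolynomial (Fin 2) ℚ) ≠ 0 := by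
    intro x hx
    have h := landen_face_bounds hx
    simp only [map_sub, map_mul, aeval_C, aeval_X, eq_ratCast, Rat.cast_natCast]
    exact mul_ne_zero (by linarith) (by linarith)
  exact ⟨⟨C 2, _, hR⟩, ⟨C 2, _, hR'⟩, ⟨C 1, _, hRP⟩, fun x _ => by simp [RFun.fn_apply],
    fun x _ => by simp [RFun.fn_apply], fun x _ => by simp [RFun.fn_apply]⟩

/-- **Stub `stub_joinLandenScaled`** (sub-goal J4 of crux `ReductionRigidity`, stmt-3407, line `Sketch`,
cycle 2: the Landen join island): **Landen's chain at level `q`, scaled by a rational `ε`, in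
normal-form syntax.** For every integer `q ≥ 2`, every rational `ε` and any representations
`s₂, s₂', sP` on the closed square with the printed integrands on it,
`[□², 2ε/(q − xy)] + [□², 2ε/((1 − q) − xy)] + [□², ε/((q − x)(q − y))] ∈ KZ.relations`:
`stub_boxLanden q` on the regular rational representatives, the scaling endomorphism `KZ.scale ε`
(`KZ.scale_mem_relations`), and three congruences (rule 1b; the middle one with the sign
`(1 − q) − xy = −((q − 1) + xy)`). [cite: KontsevichZagier2001, §1.2 rules (1)–(3)] -/
theorem stub_joinLandenScaled : ∀ (q : ℕ), 2 ≤ q → ∀ (ε : ℚ) (s₂ s₂' sP : IntegralRep 2),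
    s₂.domain = cube 2 → EqOn s₂.integrand (fun p => ((2 * ε : ℚ) : ℝ) / ((q : ℝ) - p 0 * p 1)) (cube 2) →
    s₂'.domain = cube 2 →
    EqOn s₂'.integrand (fun p => ((2 * ε : ℚ) : ℝ) / ((1 - (q : ℝ)) - p 0 * p 1)) (cube 2) →
    sP.domain = cube 2 →
    EqOn sP.integrand (fun p => (ε : ℝ) / (((q : ℝ) - p 0) * ((q : ℝ) - p 1))) (cube 2) →
    KZ.of s₂ + KZ.of s₂' + KZ.of sP ∈ KZ.relations := by
  intro q hq ε s₂ s₂' sP h₂ h₂i h₂' h₂'i hP hPi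
  have h2 : (2:ℝ) ≤ (q:ℝ) := by exact_mod_cast hq
  obtain ⟨R, R', RP, hR, hR', hRP⟩ := exists_joinLanden_rfun hq
  -- Landen's chain at level `q` on the regular rational representatives, scaled by `ε`
  have hL : KZ.of R.rep - KZ.of R'.rep + KZ.of RP.rep ∈ KZ.relations :=
    stub_boxLanden q hq R.rep R'.rep RP.rep rfl (fun x hx => hR x hx) rfl (fun x hx => hR' x hx)
      rfl fun x hx => hRP x hx
  have hε : IsAlgebraic ℚ ((ε : ℚ) : ℝ) := isAlgebraic_rat ℚ ε
  have hS := KZ.scale_mem_relations (ε : ℝ) hε hL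
  simp only [map_add, map_sub, KZ.scale_of] at hS
  -- congruences with the given representations
  have e₁ : KZ.of s₂ - KZ.of (R.rep.constMul (ε : ℝ) hε) ∈ KZ.relations :=
    KZ.of_sub_of_mem_relations_of_eqOn
      (by rw [KZ.IntegralRep.domain_constMul, RFun.rep_domain, h₂]) fun x hx => by
        rw [h₂] at hx
        simp only [KZ.IntegralRep.integrand_constMul, RFun.rep_integrand]
        rw [h₂i hx, hR x hx]
        push_cast
        ring
  have e₂ : KZ.of s₂' + KZ.of (R'.rep.constMul (ε : ℝ) hε) ∈ KZ.relations :=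
    KZ.of_add_of_mem_relations_of_eqOn_neg
      (by rw [KZ.IntegralRep.domain_constMul, RFun.rep_domain, h₂']) fun x hx => by
        rw [h₂'] at hx
        simp only [KZ.IntegralRep.integrand_constMul, RFun.rep_integrand, Pi.neg_apply]
        rw [h₂'i hx, hR' x hx]
        dsimp only
        rw [show (1 - (q:ℝ)) - x 0 * x 1 = -(((q:ℝ) - 1) + x 0 * x 1) by ring, div_neg]
        push_cast
        ring
  have e₃ : KZ.of sP - KZ.of (RP.rep.constMul (ε : ℝ) hε) ∈ KZ.relations :=
    KZ.of_sub_of_mem_relations_of_eqOn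
      (by rw [KZ.IntegralRep.domain_constMul, RFun.rep_domain, hP]) fun x hx => by
        rw [hP] at hx
        simp only [KZ.IntegralRep.integrand_constMul, RFun.rep_integrand]
        rw [hPi hx, hRP x hx]
        ring
  have e : KZ.of s₂ + KZ.of s₂' + KZ.of sP =
      (KZ.of s₂ - KZ.of (R.rep.constMul (ε : ℝ) hε)) + (KZ.of s₂' + KZ.of (R'.rep.constMul (ε : ℝ) hε)) +
        (KZ.of sP - KZ.of (RP.rep.constMul (ε : ℝ) hε)) +
        (KZ.of (R.rep.constMul (ε : ℝ) hε) - KZ.of (R'.rep.constMul (ε : ℝ) hε) +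
          KZ.of (RP.rep.constMul (ε : ℝ) hε)) := by abel
  rw [e]
  exact KZ.relations.add_mem (KZ.relations.add_mem (KZ.relations.add_mem e₁ e₂) e₃) hS

end Summit.KontsevichZagierPeriods.HermiteRigidity.ReductionRigidity

end
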